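import Mathlib.RingTheory.MvPolynomial.WeightedHomogeneous
import Mathlib.RingTheory.FiniteType
import Mathlib.RingTheory.RegularLocalRing.Polynomial
import Mathlib.Algebra.Order.Antidiag.Finsupp
import Literature.AlgebraicGeometry.Resolution.AffineBlowupAlgebra
import Literature.AlgebraicGeometry.Resolution.AffineBlowup
import HarnessLib

/-!
# Membership criterion for the Segre ring

Support file for crux stmt-ResolutionOfSingularities-15317 (`FrobeniusLadder.FRationalResolution`), line `redirect`,
lead c5, CONE PROGRAMME (rung 4′ in all dimensions on the Veronese cones `V(n,r) = Spec k[χᵈ : |d| = r]`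
and on the Segre cones `C(ℙᵃ⁻¹ × ℙᵇ⁻¹) = Spec k[xᵢyⱼ]`).
We prove the membership criterion for the Segre ring `SR(a,b) = k[xᵢyⱼ] ⊆ k[x₁,…,x_a,y₁,…,y_b]`:
a polynomial lies in `SR(a,b)` iff every monomial in its support is *balanced*, i.e. its total
degree in the `x`-block equals its total degree in the `y`-block — given the (purely combinatorial)
bipartite splitting of balanced exponent vectors into sums of vectors `e_{xᵢ} + e_{yⱼ}`, which is
taken as a hypothesis. (`→`: induction over `Algebra.adjoin`, both block degrees are additive on
products of monomials and agree on the generators `xᵢyⱼ`; `←`: a balanced monomial is a product of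
generators `xᵢyⱼ` by the splitting, and a polynomial is the `k`-combination of its monomials.)
[folklore; cf. Bruns–Herzog 1998 §6.1 (Segre products)]
-/

-- single-problem summit: the doubled namespace component is forced
set_option linter.dupNamespace false

noncomputable section

namespace Summit.ResolutionOfSingularities.ResolutionOfSingularities.Theorems.FRationalResolution

open MvPolynomial
open Literature.AlgebraicGeometry.Resolution

section Cones

variable (k : Type) [Field k]

/-- The polynomial ring in two blocks of `a` and `b` variables `xᵢ = X (inl i)`, `yⱼ = X (inr j)`. -/
local notation3 "SP[" a ", " b "]" => MvPolynomial (Fin a ⊕ Fin b) k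

/-- The Segre ring `k[xᵢyⱼ] ⊆ k[x, y]`: coordinate ring of the affine cone over the Segre embedding of
`ℙᵃ⁻¹ × ℙᵇ⁻¹`. -/
local notation3 "SR[" a ", " b "]" =>
  Algebra.adjoin k (Set.range (fun ij : Fin a × Fin b =>
    (MvPolynomial.X (Sum.inl ij.1) * MvPolynomial.X (Sum.inr ij.2) : MvPolynomial (Fin a ⊕ Fin b) k)))

/-- The generator `xᵢyⱼ` of the Segre ring is the monomial with exponent vector
`e_{inl i} + e_{inr j}` (`MvPolynomial.X_pow_eq_monomial`, `MvPolynomial.monomial_mul`). [folklore] -/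
theorem segreMemIff_X_mul_X_eq_monomial (a b : ℕ) (i : Fin a) (j : Fin b) :
    (X (Sum.inl i) * X (Sum.inr j) : SP[a, b]) =
      monomial (Finsupp.single (Sum.inl i) 1 + Finsupp.single (Sum.inr j) 1) 1 := by
  rw [← pow_one (X (Sum.inl i) : SP[a, b]), ← pow_one (X (Sum.inr j) : SP[a, b]),
    X_pow_eq_monomial, X_pow_eq_monomial, monomial_mul, one_mul]

/-- Every element of the Segre ring `SR[a, b]` has all the monomials of its support balanced: the
total degree in the `x`-block equals the total degree in the `y`-block. Induction over
`Algebra.adjoin` (`Algebra.adjoin_induction`): a generator `xᵢyⱼ` is the single monomial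
`e_{inl i} + e_{inr j}`, both of whose block degrees are `1`; a constant has support `⊆ {0}`; a sum
has support in the union of the supports; a product has support in the pointwise sum of the supports
(`MvPolynomial.support_mul`), and both block degrees are additive. [folklore] -/
theorem segreMemIff_balanced_of_mem (a b : ℕ) {f : SP[a, b]} (hf : f ∈ SR[a, b]) :
    ∀ d ∈ f.support, ∑ i : Fin a, d (Sum.inl i) = ∑ j : Fin b, d (Sum.inr j) := by
  classical
  induction hf using Algebra.adjoin_induction with
  | mem x hx =>
    obtain ⟨⟨i, j⟩, rfl⟩ := hx
    intro d hd
    have hd' : d ∈ (monomial (Finsupp.single (Sum.inl i) 1 + Finsupp.single (Sum.inr j) 1) (1 : k) :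
        SP[a, b]).support := by
      rwa [← segreMemIff_X_mul_X_eq_monomial]
    obtain rfl : d = Finsupp.single (Sum.inl i) 1 + Finsupp.single (Sum.inr j) 1 :=
      Finset.mem_singleton.mp (support_monomial_subset hd')
    simp [Finsupp.single_apply]
  | algebraMap c =>
    intro d hd
    rw [MvPolynomial.algebraMap_eq, C_apply] at hd
    obtain rfl : d = 0 := Finset.mem_singleton.mp (support_monomial_subset hd)
    simp
  | add x y _ _ hx hy =>
    intro d hd
    rcases Finset.mem_union.mp (support_add hd) with h | h
    · exact hx d h
    · exact hy d h
  | mul x y _ _ hx hy =>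
    intro d hd
    obtain ⟨u, hu, v, hv, rfl⟩ := Finset.mem_add.mp (support_mul x y hd)
    simp only [Finsupp.add_apply, Finset.sum_add_distrib]
    rw [hx u hu, hy v hv]

/-- A balanced monomial `χᵈ` (total `x`-degree = total `y`-degree `= s`) lies in the Segre ring
`SR[a, b]`, provided balanced exponent vectors split bipartitely: writing
`d = ∑ₗ (e_{inl iₗ} + e_{inr jₗ})` one has `χᵈ = ∏ₗ x_{iₗ} y_{jₗ}` (`MvPolynomial.monomial_sum_one`),
a product of generators. [folklore] -/
theorem segreMemIff_monomial_mem (a b : ℕ)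
    (hsplit : ∀ (s : ℕ) (d : Fin a ⊕ Fin b →₀ ℕ), ∑ i : Fin a, d (Sum.inl i) = s →
      ∑ j : Fin b, d (Sum.inr j) = s → ∃ e : Fin s → Fin a × Fin b,
        d = ∑ l, (Finsupp.single (Sum.inl (e l).1) 1 + Finsupp.single (Sum.inr (e l).2) 1))
    (d : Fin a ⊕ Fin b →₀ ℕ) (hd : ∑ i : Fin a, d (Sum.inl i) = ∑ j : Fin b, d (Sum.inr j)) :
    (monomial d (1 : k) : SP[a, b]) ∈ SR[a, b] := by
  obtain ⟨e, hde⟩ := hsplit _ d rfl hd.symm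
  rw [hde, monomial_sum_one]
  refine Subalgebra.prod_mem _ (fun l _ => ?_)
  rw [← segreMemIff_X_mul_X_eq_monomial]
  exact Algebra.subset_adjoin ⟨e l, rfl⟩

/-- A polynomial all of whose monomials are balanced lies in the Segre ring `SR[a, b]`, provided
balanced exponent vectors split bipartitely: write `f = ∑_{d ∈ supp f} (coeff d f) • χᵈ`
(`MvPolynomial.as_sum`) and use that each balanced `χᵈ` is a product of generators
(`segreMemIff_monomial_mem`). [folklore] -/
theorem segreMemIff_mem_of_balanced (a b : ℕ)
    (hsplit : ∀ (s : ℕ) (d : Fin a ⊕ Fin b →₀ ℕ), ∑ i : Fin a, d (Sum.inl i) = s →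
      ∑ j : Fin b, d (Sum.inr j) = s → ∃ e : Fin s → Fin a × Fin b,
        d = ∑ l, (Finsupp.single (Sum.inl (e l).1) 1 + Finsupp.single (Sum.inr (e l).2) 1))
    {f : SP[a, b]} (hf : ∀ d ∈ f.support, ∑ i : Fin a, d (Sum.inl i) = ∑ j : Fin b, d (Sum.inr j)) :
    f ∈ SR[a, b] := by
  rw [f.as_sum]
  refine Subalgebra.sum_mem _ (fun d hd => ?_)
  have hmon := segreMemIff_monomial_mem k a b hsplit d (hf d hd)
  have hcd : (monomial d (coeff d f) : SP[a, b]) = coeff d f • (monomial d (1 : k) : SP[a, b]) := by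
    rw [smul_monomial, smul_eq_mul, mul_one]
  rw [hcd]
  exact Subalgebra.smul_mem _ hmon _

/-- **Membership criterion for the Segre ring.** A polynomial `f ∈ k[x₁,…,x_a,y₁,…,y_b]` lies in the
Segre ring `SR[a, b] = k[xᵢyⱼ]` iff every monomial in its support is BALANCED (total `x`-degree =
total `y`-degree). (`→`: `Algebra.adjoin_induction`, balance is additive on products and holds for the
generators; `←`: a balanced monomial is a product of generators `xᵢyⱼ` by the bipartite splitting
hypothesis `hsplit`, and `f` is the `k`-combination of its monomials.)
[folklore; cf. Bruns–Herzog 1998 §6.1 (Segre products)] -/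
theorem stub_segre_mem_iff (a b : ℕ)
    (hsplit : ∀ (s : ℕ) (d : Fin a ⊕ Fin b →₀ ℕ), ∑ i : Fin a, d (Sum.inl i) = s →
      ∑ j : Fin b, d (Sum.inr j) = s → ∃ e : Fin s → Fin a × Fin b,
        d = ∑ l, (Finsupp.single (Sum.inl (e l).1) 1 + Finsupp.single (Sum.inr (e l).2) 1))
    (f : SP[a, b]) :
    f ∈ SR[a, b] ↔ ∀ d ∈ f.support, ∑ i : Fin a, d (Sum.inl i) = ∑ j : Fin b, d (Sum.inr j) :=
  ⟨segreMemIff_balanced_of_mem k a b, segreMemIff_mem_of_balanced k a b hsplit⟩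

end Cones

end Summit.ResolutionOfSingularities.ResolutionOfSingularities.Theorems.FRationalResolution

end
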